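import Summits.QuantumFields.BalabanUV.T4Continuum.Support.BlockAverageCurrentAbelian
import Summits.QuantumFields.BalabanUV.T4Continuum.Support.BlockAverageLoopLogCore

/-!
# T⁴ programme, node NE3 — candidate row S3-D7 «A-H4-cur», file 1 (NEAR-IDENTITY GAUGE): the transported difference of
# two ADJACENT coarse plaquette variables of Bałaban's averaged configuration (42) is
# `≤ L³·(flux-Lipschitz data) + O(θ²)` — the first-order term is the ABELIAN one, everything else is second order

NE3 formalisation swarm, leaf seat `b2b-balaban-t4-ne3-formalise-leaf-05` (gen 3), FIRST REFUSAL on the candidate row S3-D7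
(typer ρ36 (v)); SHAPE v0 `t4/formal/NE3/Statements/S3-D7-SHAPE-v0.md`; companion of `Support/BlockAverageCurrentAbelian`
(the abelian sanity file, DAG node A-H4-ab).  PURPOSE (D-s3-1 ∕ the re-cut socket of (50S)): the CURRENT condition (1.9)
of B11's class (6) for the sandwich's AVERAGED competitor `rescale L (bavg L U)` — the binder `h4` of
`MinimalActionRateExists.actionRate_of_exists` read over `MinimalActionClassSix.ClassSix` (leaf-04 g2) — needs the
transported differences of ADJACENT coarse plaquette variables of the averaged field.  THIS FILE proves the core bound in
the NEAR-IDENTITY GAUGE used by B7 Prop. 1's own proof (`B7Prop1Explicit.prop1_core`: bond variables within `α/2` of `1`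
on an `l¹`-ball), for `U(N)`-valued configurations:

§1 LOCAL versions of the abelian bookkeeping of the companion file (`norm_flux_shift_le_local`,
   `norm_coarseFlux_shift_sub_le_local`: hypotheses only on an `l¹`-ball);
§2 **`norm_transDiff_cplaq_bavg_le`**: for unitary `V₀` with `‖V₀(b) − 1‖ ≤ α/2` on the ball of radius
   `2dL + 8L + 8` around the coarse corner `q = L·x`, plaquettes within `a` of `1`, and TRANSPORTED PLAQUETTE DIFFERENCES
   `‖Ad_{V₀(x,λ)} V₀(∂p(x+e_λ)) − V₀(∂p(x))‖ ≤ g₁` (the flux-Lipschitz datum in gauge-invariant form), with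
   `(2dL + 2L)·α ≤ θ ≤ 1/64`:
   `‖R(W̄(x−e_ν, ν)⁻¹) W̄(∂P(x − e_ν)) − W̄(∂P(x))‖ ≤ L³·(g₁ + α·a + 2ρ(4α)) + 520·θ²`, `W̄ = rescale L (bavg L V₀)`,
   `ρ(t) = e^t − 1 − t` — i.e. ONE term of B8's `covDiv` of the averaged configuration, before the `η⁻¹` and the plane
   count.  Ingredients BY NAME: `B7Prop1Explicit.side_estimate` (each averaged bond `= 1 ± T_c + O(50θ²)`, (49)/(50)),
   `norm_prod4_sub_one_sub_le`, `bond_log`, `walk_linear` ((46)-type: `V₀(∂p) − 1 = A(∂p) + O(ρ(4α))`),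
   `corner_cancellation` + `stokes` through the companion's `coarseFlux_eq_avg_stokes`,
   `BlockAverageLoopLogCore.norm_units_conj_sub_self_le` (conjugation by the averaged bond costs `2‖w − 1‖·‖P′ − 1‖`).
What is NOT here (file 2): the axial gauge that produces the near-identity hypothesis from `RegularSup` data
(`B8Lemma1NonAbelian.axial_bond_bound_sharp`), gauge covariance ((45), (1.11)), the plane count and the scaling to
`‖covDiv ((L^k)⁻¹) …‖ ≤ 2(d−1)·(c + K(d,L)·b²)/(L^k)²`, the `ClassSix` corollary.

HONEST FRAMING.  Kinematics of (42) (finite-T⁴ rung (B)+1 bookkeeping); OURS; NOTHING about Bałaban's minimisers or NE3 is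
asserted; no conditional of the cell (`BetaPertH`, (B), G-an2-4) is used or hidden; NE3 is NOT proved; spine PROVED 0∕9;
NOT infinite volume, NOT a mass gap, NOT Clay, NOT summit progress.  ABSOLUTE RULE kept: no printed sentence is a
hypothesis ([Balaban1985Averaging] (42)–(50) pp. 23–25 enter only through the tree's definitions and theorems); 0 `def`,
0 `sorry`.  PLACEMENT: `Summits/QuantumFields/BalabanUV/`; imports the companion (and through it `AbelianBlockAverage`,
`SmoothRefineNeutral`, `MinimalActionClassSix`, `B8Ineq132`, `RungeUnits`) BY NAME; restates nothing.
-/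

set_option autoImplicit false

open scoped BigOperators Matrix Matrix.Norms.L2Operator
open NormedSpace Finset

namespace Summit.QuantumFields.BalabanUV.T4Continuum.BlockAverageCurrentNearId

open Literature.MathematicalPhysics.QuantumFieldTheory.Balaban1983to89
open B7Prop1Explicit B7Prop2Explicit B7Prop1Local MatrixLog UnitaryModel
open B7Eq78Linearization (conjR conjR_apply)
open B8Ineq132 (plaqF)
open T4AveragingDeficitWall (IsUnitaryCfg Ad)
open AveragingDeficitTransport (mem_U1_of_unitary)
open BlockAverageLoopLogCore (norm_units_conj_sub_self_le)
open BlockAverageCurrentAbelian (coarseFlux_eq_avg_stokes)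

noncomputable section

variable {d : ℕ}

/-! ## §1 Local abelian bookkeeping -/

section Local

variable {𝔸 : Type*} [NormedRing 𝔸] [NormedAlgebra ℂ 𝔸]

omit [NormedAlgebra ℂ 𝔸] in
/-- A fine flux moved by `n` steps changes by `≤ n·g` — LOCAL form (hypothesis on the `l¹`-ball of radius `R` around
`y`, all intermediate points inside). [folklore] -/
theorem norm_flux_shift_le_local (A : Site d → Fin d → 𝔸) (y : Site d) (R : ℕ) {g : ℝ} {μ ν : Fin d}
    (hg : ∀ (x : Site d) (lam : Fin d), l1 (x - y) ≤ R →
      ‖asum A (x + e lam) (plaqWord μ ν) - asum A x (plaqWord μ ν)‖ ≤ g)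
    (x : Site d) (lam : Fin d) :
    ∀ n : ℕ, l1 (x - y) + n ≤ R + 1 →
      ‖asum A (x + (n : ℤ) • e lam) (plaqWord μ ν) - asum A x (plaqWord μ ν)‖ ≤ n * g
  | 0, _ => by simp
  | n + 1, hn => by
    have ih := norm_flux_shift_le_local A y R hg x lam n (by omega)
    have hpt : l1 (x + (n : ℤ) • e lam - y) ≤ R := by
      have h1 := l1_add_le (x - y) ((n : ℤ) • e lam)
      rw [l1_zsmul_e, Int.natAbs_natCast, show x - y + (n : ℤ) • e lam = x + (n : ℤ) • e lam - y by abel] at h1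
      omega
    have hstep := hg (x + (n : ℤ) • e lam) lam hpt
    have e1 : x + ((n + 1 : ℕ) : ℤ) • e lam = x + (n : ℤ) • e lam + e lam := by
      simp only [Nat.cast_succ, add_smul, one_smul, add_assoc]
    rw [e1]
    calc ‖asum A (x + (n : ℤ) • e lam + e lam) (plaqWord μ ν) - asum A x (plaqWord μ ν)‖
        = ‖(asum A (x + (n : ℤ) • e lam + e lam) (plaqWord μ ν) - asum A (x + (n : ℤ) • e lam) (plaqWord μ ν))
            + (asum A (x + (n : ℤ) • e lam) (plaqWord μ ν) - asum A x (plaqWord μ ν))‖ := by rw [sub_add_sub_cancel]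
      _ ≤ g + n * g := (norm_add_le _ _).trans (add_le_add hstep ih)
      _ = ((n + 1 : ℕ) : ℝ) * g := by push_cast; ring

/-- **The coarse exponent moved by one coarse step**, LOCAL form: if the fine fluxes are `g`-Lipschitz on the ball of
radius `R` around `y` and `l1 (q − y) + d·L + 3·L ≤ R`, then the exponent at `q + L e_λ` minus the exponent at `q` is
`≤ L³·g`. [folklore] -/
theorem norm_coarseFlux_shift_sub_le_local {L : ℕ} (hL : 1 ≤ L) (A : Site d → Fin d → 𝔸) (y : Site d) (R : ℕ)
    {g : ℝ} {μ ν : Fin d}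
    (hg : ∀ (x : Site d) (lam : Fin d), l1 (x - y) ≤ R →
      ‖asum A (x + e lam) (plaqWord μ ν) - asum A x (plaqWord μ ν)‖ ≤ g)
    (q : Site d) (hq : l1 (q - y) + (d * L + 3 * L) ≤ R) (lam : Fin d) :
    ‖(Tside L A (q + (L : ℤ) • e lam) μ + Tside L A (q + (L : ℤ) • e lam + (L : ℤ) • e μ) ν
          - Tside L A (q + (L : ℤ) • e lam + (L : ℤ) • e ν) μ - Tside L A (q + (L : ℤ) • e lam) ν)
        - (Tside L A q μ + Tside L A (q + (L : ℤ) • e μ) ν - Tside L A (q + (L : ℤ) • e ν) μ - Tside L A q ν)‖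
      ≤ (L : ℝ) ^ 3 * g := by
  rw [coarseFlux_eq_avg_stokes, coarseFlux_eq_avg_stokes, ← Finset.sum_sub_distrib]
  simp only [← smul_sub]
  refine norm_avg_le L hL _ fun r => ?_
  rw [← Finset.sum_sub_distrib]
  have hterm : ∀ i ∈ Finset.range L, ∀ j ∈ Finset.range L,
      ‖asum A (q + (L : ℤ) • e lam + boxVec L r + (i : ℤ) • e μ + (j : ℤ) • e ν) (plaqWord μ ν)
        - asum A (q + boxVec L r + (i : ℤ) • e μ + (j : ℤ) • e ν) (plaqWord μ ν)‖ ≤ (L : ℝ) * g := by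
    intro i hi j hj
    rw [Finset.mem_range] at hi hj
    set p : Site d := q + boxVec L r + (i : ℤ) • e μ + (j : ℤ) • e ν with hp
    have hpR : l1 (p - y) + L ≤ R + 1 := by
      have h1 := l1_add_le (q - y) (boxVec L r + (i : ℤ) • e μ + (j : ℤ) • e ν)
      have h2 := l1_add_le (boxVec L r + (i : ℤ) • e μ) ((j : ℤ) • e ν)
      have h3 := l1_add_le (boxVec L r) ((i : ℤ) • e μ)
      have h4 := l1_boxVec_le L r
      rw [l1_zsmul_e, Int.natAbs_natCast] at h2 h3
      rw [show q - y + (boxVec L r + (i : ℤ) • e μ + (j : ℤ) • e ν) = p - y by rw [hp]; abel] at h1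
      have h5 : d * (L - 1) + (L - 1) + (L - 1) + L ≤ d * L + 3 * L := by
        have := Nat.mul_le_mul_left d (Nat.sub_le L 1); omega
      omega
    have h := norm_flux_shift_le_local A y R hg p lam L hpR
    rwa [show p + (L : ℤ) • e lam = q + (L : ℤ) • e lam + boxVec L r + (i : ℤ) • e μ + (j : ℤ) • e ν by
      rw [hp]; abel] at h
  calc ‖∑ i ∈ Finset.range L, (∑ j ∈ Finset.range L,
          asum A (q + (L : ℤ) • e lam + boxVec L r + (i : ℤ) • e μ + (j : ℤ) • e ν) (plaqWord μ ν)
          - ∑ j ∈ Finset.range L, asum A (q + boxVec L r + (i : ℤ) • e μ + (j : ℤ) • e ν) (plaqWord μ ν))‖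
      ≤ ∑ i ∈ Finset.range L, ‖∑ j ∈ Finset.range L,
          asum A (q + (L : ℤ) • e lam + boxVec L r + (i : ℤ) • e μ + (j : ℤ) • e ν) (plaqWord μ ν)
          - ∑ j ∈ Finset.range L, asum A (q + boxVec L r + (i : ℤ) • e μ + (j : ℤ) • e ν) (plaqWord μ ν)‖ :=
        norm_sum_le _ _
    _ ≤ ∑ _i ∈ Finset.range L, L * ((L : ℝ) * g) := by
        refine Finset.sum_le_sum fun i hi => ?_
        rw [← Finset.sum_sub_distrib]
        calc _ ≤ ∑ j ∈ Finset.range L, ‖asum A (q + (L : ℤ) • e lam + boxVec L r + (i : ℤ) • e μ + (j : ℤ) • e ν)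
              (plaqWord μ ν) - asum A (q + boxVec L r + (i : ℤ) • e μ + (j : ℤ) • e ν) (plaqWord μ ν)‖ :=
              norm_sum_le _ _
          _ ≤ ∑ _j ∈ Finset.range L, (L : ℝ) * g := Finset.sum_le_sum fun j hj => hterm i hi j hj
          _ = L * ((L : ℝ) * g) := by rw [Finset.sum_const, Finset.card_range, nsmul_eq_mul]
    _ = (L : ℝ) ^ 3 * g := by rw [Finset.sum_const, Finset.card_range, nsmul_eq_mul]; ring

end Local

/-! ## §2 Abstract second-order bookkeeping (small contexts, reusable) -/

section Algebra

variable {𝔸 : Type*} [NormedRing 𝔸] [NormOneClass 𝔸]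

/-- The polynomial tail of `norm_prod4_sub_one_sub_le` at `φ = 2θ`, `δ = 50θ²`, `θ ≤ 1/64`: `≤ 228θ²`. [folklore] -/
theorem prod4_tail_le {θ : ℝ} (hθ0 : 0 ≤ θ) (hθ1 : θ ≤ 1 / 64) :
    4 * (50 * θ ^ 2) + (2 * θ) ^ 2 * (6 + 4 * (2 * θ) + (2 * θ) ^ 2) ≤ 228 * θ ^ 2 := by
  have h5 : 32 * θ + 16 * θ ^ 2 ≤ 4 := by nlinarith
  have h6 : θ ^ 2 * (32 * θ + 16 * θ ^ 2) ≤ θ ^ 2 * 4 := mul_le_mul_of_nonneg_left h5 (sq_nonneg θ)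
  have e : 4 * (50 * θ ^ 2) + (2 * θ) ^ 2 * (6 + 4 * (2 * θ) + (2 * θ) ^ 2)
      = 224 * θ ^ 2 + θ ^ 2 * (32 * θ + 16 * θ ^ 2) := by ring
  rw [e]; linarith

omit [NormOneClass 𝔸] in
/-- FOUR NEAR-IDENTITY FACTORS: `‖F_i − 1‖ ≤ 2θ`, `‖F_i − 1 − t_i‖ ≤ 50θ²`, `θ ≤ 1/64` ⇒
`‖F₁F₂F₃F₄ − 1 − (t₁+t₂+t₃+t₄)‖ ≤ 228θ²` (the tree's `norm_prod4_sub_one_sub_le`). [folklore] -/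
theorem norm_prod4_le {F₁ F₂ F₃ F₄ t₁ t₂ t₃ t₄ : 𝔸} {θ : ℝ} (hθ0 : 0 ≤ θ) (hθ1 : θ ≤ 1 / 64)
    (h1 : ‖F₁ - 1‖ ≤ 2 * θ) (h2 : ‖F₂ - 1‖ ≤ 2 * θ) (h3 : ‖F₃ - 1‖ ≤ 2 * θ) (h4 : ‖F₄ - 1‖ ≤ 2 * θ)
    (d1 : ‖F₁ - 1 - t₁‖ ≤ 50 * θ ^ 2) (d2 : ‖F₂ - 1 - t₂‖ ≤ 50 * θ ^ 2) (d3 : ‖F₃ - 1 - t₃‖ ≤ 50 * θ ^ 2)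
    (d4 : ‖F₄ - 1 - t₄‖ ≤ 50 * θ ^ 2) :
    ‖F₁ * F₂ * F₃ * F₄ - 1 - (t₁ + t₂ + t₃ + t₄)‖ ≤ 228 * θ ^ 2 :=
  (norm_prod4_sub_one_sub_le (by positivity) h1 h2 h3 h4 d1 d2 d3 d4).trans (prod4_tail_le hθ0 hθ1)

omit [NormOneClass 𝔸] in
/-- `‖t‖ ≤ 3θ` from `‖F − 1‖ ≤ 2θ`, `‖F − 1 − t‖ ≤ 50θ²`, `θ ≤ 1/64`. [folklore] -/
theorem norm_lin_le {F t : 𝔸} {θ : ℝ} (hθ0 : 0 ≤ θ) (hθ1 : θ ≤ 1 / 64) (hF : ‖F - 1‖ ≤ 2 * θ)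
    (hFt : ‖F - 1 - t‖ ≤ 50 * θ ^ 2) : ‖t‖ ≤ 3 * θ := by
  have h : ‖t‖ ≤ ‖F - 1‖ + ‖F - 1 - t‖ := by
    calc ‖t‖ = ‖(F - 1) - (F - 1 - t)‖ := by rw [sub_sub_cancel]
      _ ≤ _ := norm_sub_le _ _
  nlinarith

omit [NormOneClass 𝔸] in
/-- The size of a four-term exponent `t₁ + t₂ + t₃ + t₄` with `‖t_i‖ ≤ 3θ`: `≤ 12θ`. [folklore] -/
theorem norm_sum4_le {t₁ t₂ t₃ t₄ : 𝔸} {θ : ℝ} (h1 : ‖t₁‖ ≤ 3 * θ) (h2 : ‖t₂‖ ≤ 3 * θ) (h3 : ‖t₃‖ ≤ 3 * θ)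
    (h4 : ‖t₄‖ ≤ 3 * θ) : ‖t₁ + t₂ + t₃ + t₄‖ ≤ 12 * θ := by
  have := norm_add_le (t₁ + t₂ + t₃) t₄
  have := norm_add_le (t₁ + t₂) t₃
  have := norm_add_le t₁ t₂
  linarith

omit [NormOneClass 𝔸] in
/-- `‖P − 1‖ ≤ 16θ` from `‖P − 1 − Φ‖ ≤ 228θ²`, `‖Φ‖ ≤ 12θ`, `θ ≤ 1/64`. [folklore] -/
theorem norm_sub_one_le_sixteen {P Φ : 𝔸} {θ : ℝ} (hθ0 : 0 ≤ θ) (hθ1 : θ ≤ 1 / 64)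
    (hE : ‖P - 1 - Φ‖ ≤ 228 * θ ^ 2) (hΦ : ‖Φ‖ ≤ 12 * θ) : ‖P - 1‖ ≤ 16 * θ := by
  have h : ‖P - 1‖ ≤ ‖P - 1 - Φ‖ + ‖Φ‖ := by
    calc ‖P - 1‖ = ‖(P - 1 - Φ) + Φ‖ := by rw [sub_add_cancel]
      _ ≤ _ := norm_add_le _ _
  nlinarith

omit [NormOneClass 𝔸] in
/-- `v X v⁻¹ − X = v (X − 1) v⁻¹ − (X − 1)` for a unit `v`. [folklore] -/
theorem units_conj_sub_eq (v : 𝔸ˣ) (X : 𝔸) :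
    (v : 𝔸) * X * ((v⁻¹ : 𝔸ˣ) : 𝔸) - X = (v : 𝔸) * (X - 1) * ((v⁻¹ : 𝔸ˣ) : 𝔸) - (X - 1) := by
  rw [mul_sub, sub_mul, mul_one, Units.mul_inv]; abel

/-- **THE ASSEMBLY**: conjugated second plaquette minus first plaquette, from the two second-order expansions, the
size of the second plaquette, the near-identity conjugating unit and the shift of the exponents:
`‖w P′ w⁻¹ − P‖ ≤ s + 520θ²`. [folklore] -/
theorem norm_conj_sub_le_assembly {P P' Φ Φ' : 𝔸} {w : 𝔸ˣ} {θ s : ℝ} (hθ0 : 0 ≤ θ) (hw : w ∈ U1 𝔸)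
    (hw1 : ‖(w : 𝔸) - 1‖ ≤ 2 * θ) (hE : ‖P - 1 - Φ‖ ≤ 228 * θ ^ 2) (hE' : ‖P' - 1 - Φ'‖ ≤ 228 * θ ^ 2)
    (hP'1 : ‖P' - 1‖ ≤ 16 * θ) (hshift : ‖Φ - Φ'‖ ≤ s) :
    ‖(w : 𝔸) * P' * ((w⁻¹ : 𝔸ˣ) : 𝔸) - P‖ ≤ s + 520 * θ ^ 2 := by
  have hconj : ‖(w : 𝔸) * P' * ((w⁻¹ : 𝔸ˣ) : 𝔸) - P'‖ ≤ 64 * θ ^ 2 := by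
    rw [units_conj_sub_eq]
    refine (norm_units_conj_sub_self_le hw _).trans ?_
    calc 2 * ‖(w : 𝔸) - 1‖ * ‖P' - 1‖ ≤ 2 * (2 * θ) * (16 * θ) := by gcongr
      _ = 64 * θ ^ 2 := by ring
  have hsplit : (w : 𝔸) * P' * ((w⁻¹ : 𝔸ˣ) : 𝔸) - P
      = ((w : 𝔸) * P' * ((w⁻¹ : 𝔸ˣ) : 𝔸) - P') + ((P' - 1 - Φ') - (P - 1 - Φ) - (Φ - Φ')) := by abel
  rw [hsplit]
  calc _ ≤ ‖(w : 𝔸) * P' * ((w⁻¹ : 𝔸ˣ) : 𝔸) - P'‖ + ‖(P' - 1 - Φ') - (P - 1 - Φ) - (Φ - Φ')‖ := norm_add_le _ _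
    _ ≤ 64 * θ ^ 2 + (228 * θ ^ 2 + 228 * θ ^ 2 + s) := by
        refine add_le_add hconj ?_
        calc _ ≤ ‖(P' - 1 - Φ') - (P - 1 - Φ)‖ + ‖Φ - Φ'‖ := norm_sub_le _ _
          _ ≤ (‖P' - 1 - Φ'‖ + ‖P - 1 - Φ‖) + ‖Φ - Φ'‖ := add_le_add (norm_sub_le _ _) le_rfl
          _ ≤ _ := add_le_add (add_le_add hE' hE) hshift
    _ = s + 520 * θ ^ 2 := by ring

/-- **THE ABELIAN FLUX IS LIPSCHITZ** when the transported plaquette differences are: with `‖P₁ − 1 − f₁‖ ≤ ρ`,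
`‖P₀ − 1 − f₀‖ ≤ ρ` (the `asum`-fluxes `f_i` of the exponential bond field), `‖v P₁ v⁻¹ − P₀‖ ≤ g₁`, `‖v − 1‖ ≤ α/2`,
`‖P₁ − 1‖ ≤ a`, `v ∈ U1`: `‖f₁ − f₀‖ ≤ g₁ + α·a + 2ρ`. [folklore] -/
theorem norm_flux_sub_le_of_transDiff {P₀ P₁ f₀ f₁ : 𝔸} {v : 𝔸ˣ} {g₁ α a ρ : ℝ} (hv : v ∈ U1 𝔸)
    (hvb : ‖(v : 𝔸) - 1‖ ≤ α / 2) (hP₁ : ‖P₁ - 1‖ ≤ a)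
    (hΔ : ‖(v : 𝔸) * P₁ * ((v⁻¹ : 𝔸ˣ) : 𝔸) - P₀‖ ≤ g₁) (r0 : ‖P₀ - 1 - f₀‖ ≤ ρ) (r1 : ‖P₁ - 1 - f₁‖ ≤ ρ) :
    ‖f₁ - f₀‖ ≤ g₁ + α * a + 2 * ρ := by
  have hα : 0 ≤ α / 2 := (norm_nonneg _).trans hvb
  have hAd : ‖(v : 𝔸) * P₁ * ((v⁻¹ : 𝔸ˣ) : 𝔸) - P₁‖ ≤ α * a := by
    rw [units_conj_sub_eq]
    refine (norm_units_conj_sub_self_le hv _).trans ?_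
    calc 2 * ‖(v : 𝔸) - 1‖ * ‖P₁ - 1‖ ≤ 2 * (α / 2) * a := by gcongr
      _ = α * a := by ring
  have hdiff : ‖P₁ - P₀‖ ≤ g₁ + α * a := by
    calc ‖P₁ - P₀‖ = ‖((v : 𝔸) * P₁ * ((v⁻¹ : 𝔸ˣ) : 𝔸) - P₀) - ((v : 𝔸) * P₁ * ((v⁻¹ : 𝔸ˣ) : 𝔸) - P₁)‖ := by
          congr 1; abel
      _ ≤ g₁ + α * a := (norm_sub_le _ _).trans (add_le_add hΔ hAd)
  have e : f₁ - f₀ = (P₁ - P₀) - (P₁ - 1 - f₁) + (P₀ - 1 - f₀) := by abel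
  rw [e]
  calc _ ≤ ‖(P₁ - P₀) - (P₁ - 1 - f₁)‖ + ‖P₀ - 1 - f₀‖ := norm_add_le _ _
    _ ≤ (‖P₁ - P₀‖ + ‖P₁ - 1 - f₁‖) + ‖P₀ - 1 - f₀‖ := add_le_add (norm_sub_le _ _) le_rfl
    _ ≤ (g₁ + α * a + ρ) + ρ := add_le_add (add_le_add hdiff r1) r0
    _ = g₁ + α * a + 2 * ρ := by ring

end Algebra

/-! ## §3 The transported difference of adjacent coarse plaquettes in the near-identity gauge -/

section NearId

variable {n : Type*} [Fintype n] [DecidableEq n] [Nonempty n]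

omit [Fintype n] [DecidableEq n] [Nonempty n] in
/-- `(plaqWord μ ν).length = 4`. [folklore] -/
theorem length_plaqWord (μ ν : Fin d) : (plaqWord μ ν : List (Letter d)).length = 4 := by
  simp [plaqWord]

/-- `l1` of an `L`-step: `l1 (L • e_κ) = L`. [folklore] -/
theorem l1_Lstep (L : ℕ) (κ : Fin d) : l1 ((L : ℤ) • (e κ : Site d)) = L := by
  rw [l1_zsmul_e, Int.natAbs_natCast]

/-- **S3-D7 CORE, NEAR-IDENTITY GAUGE.**  `V₀` unitary with `‖V₀(b) − 1‖ ≤ α/2` on the `l¹`-ball of radius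
`2dL + 8L + 8` around the coarse corner `q = L·x`, all plaquette variables of the plane `(μ, ν)` within `a` of `1`,
transported plaquette differences `‖Ad_{V₀(y,λ)}V₀(∂p(y + e_λ)) − V₀(∂p(y))‖ ≤ g₁` in that plane, and
`(2dL+2L)·α ≤ θ ≤ 1/64`.  Then for the averaged configuration `W̄ = rescale L (bavg L V₀)` and every direction `λ`:
`‖R(W̄(x − e_λ, λ)⁻¹)·W̄(∂P(x − e_λ)) − W̄(∂P(x))‖ ≤ L³·(g₁ + α·a + 2ρ(4α)) + 520·θ²` (`ρ(t) = e^t − 1 − t`). [folklore] -/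
theorem norm_transDiff_cplaq_bavg_le {L : ℕ} (hL : 1 ≤ L) {V₀ : Site d → Fin d → (Matrix n n ℂ)ˣ}
    (hV₀ : IsUnitaryCfg V₀) (q : Site d) {α a g₁ θ : ℝ} (hα : 0 ≤ α)
    (hθ : ((2 * (d * L) + L + L : ℕ) : ℝ) * α ≤ θ) (hθ1 : θ ≤ 1 / 64)
    (hb : ∀ (y : Site d) (κ : Fin d), l1 (y - q) ≤ 2 * (d * L) + 8 * L + 8 →
      ‖((V₀ y κ : (Matrix n n ℂ)ˣ) : Matrix n n ℂ) - 1‖ ≤ α / 2)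
    {μ ν : Fin d}
    (h44 : ∀ (y : Site d), ‖((hol V₀ y (plaqWord μ ν) : (Matrix n n ℂ)ˣ) : Matrix n n ℂ) - 1‖ ≤ a)
    (hΔ : ∀ (y : Site d) (lam : Fin d),
      ‖Ad (V₀ y lam) ((hol V₀ (y + e lam) (plaqWord μ ν) : (Matrix n n ℂ)ˣ) : Matrix n n ℂ)
        - ((hol V₀ y (plaqWord μ ν) : (Matrix n n ℂ)ˣ) : Matrix n n ℂ)‖ ≤ g₁)
    (x : Site d) (hx : (L : ℤ) • x = q) (lam : Fin d) :
    ‖conjR (rescale L (bavg L V₀) (x - e lam) lam)⁻¹ (plaqF (rescale L (bavg L V₀)) μ ν (x - e lam))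
        - plaqF (rescale L (bavg L V₀)) μ ν x‖
      ≤ (L : ℝ) ^ 3 * (g₁ + α * a + 2 * expRem (4 * α)) + 520 * θ ^ 2 := by
  letI : NormedAlgebra ℚ (Matrix n n ℂ) := NormedAlgebra.restrictScalars ℚ ℂ (Matrix n n ℂ)
  have hd : 1 ≤ d := μ.pos
  have hθ0 : 0 ≤ θ := le_trans (by positivity) hθ
  have hcoef : (4 : ℝ) ≤ ((2 * (d * L) + L + L : ℕ) : ℝ) := by
    have : 4 ≤ 2 * (d * L) + L + L := by nlinarith
    exact_mod_cast this
  have hα1 : α ≤ 1 := by nlinarith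
  -- the bond field on the region
  have hVA := bond_log (V₀ := V₀) q (2 * (d * L) + 8 * L + 8) hα1 hb
  have hV1 : ∀ y κ, V₀ y κ ∈ U1 (Matrix n n ℂ) := fun y κ => mem_U1_of_unitary (hV₀ y κ)
  -- the second corner
  have hq'q : q - (L : ℤ) • e lam + (L : ℤ) • e lam = q := sub_add_cancel _ _
  have hxq' : (L : ℤ) • (x - e lam) = q - (L : ℤ) • e lam := by rw [smul_sub, hx]
  -- side estimates: every base within `2L` of `q`
  have hside : ∀ (b : Site d) (κ : Fin d), l1 (b - q) ≤ 2 * L →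
      ‖((bavg L V₀ b κ : (Matrix n n ℂ)ˣ) : Matrix n n ℂ) - 1‖ ≤ 2 * θ ∧
      ‖((bavg L V₀ b κ : (Matrix n n ℂ)ˣ) : Matrix n n ℂ) - 1
          - Tside L (fun y κ => mlog ((V₀ y κ : (Matrix n n ℂ)ˣ) : Matrix n n ℂ)) b κ‖ ≤ 50 * θ ^ 2 ∧
      ‖(((bavg L V₀ b κ)⁻¹ : (Matrix n n ℂ)ˣ) : Matrix n n ℂ) - 1‖ ≤ 2 * θ ∧
      ‖(((bavg L V₀ b κ)⁻¹ : (Matrix n n ℂ)ˣ) : Matrix n n ℂ) - 1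
          - (-Tside L (fun y κ => mlog ((V₀ y κ : (Matrix n n ℂ)ˣ) : Matrix n n ℂ)) b κ)‖ ≤ 50 * θ ^ 2 ∧
      ∀ r : Fin d → Fin L, ‖((Wcx L V₀ b κ (boxVec L r) : (Matrix n n ℂ)ˣ) : Matrix n n ℂ) - 1‖ ≤ 2 * θ :=
    fun b κ hbq => side_estimate V₀ _ q _ hα hVA L hL b κ (by omega) hθ hθ0 hθ1
  -- l¹ distances of the side bases
  have l0 : l1 (q - q) ≤ 2 * L := by
    rw [sub_self, show (0 : Site d) = ((0 : ℕ) : ℤ) • e μ by simp, l1_zsmul_e]; simp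
  have lμ : l1 (q + (L : ℤ) • e μ - q) ≤ 2 * L := by rw [add_sub_cancel_left, l1_Lstep]; omega
  have lν : l1 (q + (L : ℤ) • e ν - q) ≤ 2 * L := by rw [add_sub_cancel_left, l1_Lstep]; omega
  have l0' : l1 (q - (L : ℤ) • e lam - q) ≤ 2 * L := by
    rw [show q - (L : ℤ) • e lam - q = -((L : ℤ) • e lam) by abel, l1_neg, l1_Lstep]; omega
  have lμ' : l1 (q - (L : ℤ) • e lam + (L : ℤ) • e μ - q) ≤ 2 * L := by
    rw [show q - (L : ℤ) • e lam + (L : ℤ) • e μ - q = (L : ℤ) • e μ + -((L : ℤ) • e lam) by abel]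
    refine (l1_add_le _ _).trans ?_
    rw [l1_neg, l1_Lstep, l1_Lstep]; omega
  have lν' : l1 (q - (L : ℤ) • e lam + (L : ℤ) • e ν - q) ≤ 2 * L := by
    rw [show q - (L : ℤ) • e lam + (L : ℤ) • e ν - q = (L : ℤ) • e ν + -((L : ℤ) • e lam) by abel]
    refine (l1_add_le _ _).trans ?_
    rw [l1_neg, l1_Lstep, l1_Lstep]; omega
  obtain ⟨f1, e1, -, -, -⟩ := hside q μ l0
  obtain ⟨f2, e2, -, -, -⟩ := hside (q + (L : ℤ) • e μ) ν lμ
  obtain ⟨-, -, f3, e3, -⟩ := hside (q + (L : ℤ) • e ν) μ lν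
  obtain ⟨-, -, f4, e4, -⟩ := hside q ν l0
  obtain ⟨g1, d1, -, -, -⟩ := hside (q - (L : ℤ) • e lam) μ l0'
  obtain ⟨g2, d2, -, -, -⟩ := hside (q - (L : ℤ) • e lam + (L : ℤ) • e μ) ν lμ'
  obtain ⟨-, -, g3, d3, -⟩ := hside (q - (L : ℤ) • e lam + (L : ℤ) • e ν) μ lν'
  obtain ⟨-, -, g4, d4, -⟩ := hside (q - (L : ℤ) • e lam) ν l0'
  obtain ⟨-, -, hw1, -, hWl⟩ := hside (q - (L : ℤ) • e lam) lam l0'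
  -- the two second-order expansions
  have hE := norm_prod4_le hθ0 hθ1 f1 f2 f3 f4 e1 e2 e3 e4
  have hE' := norm_prod4_le hθ0 hθ1 g1 g2 g3 g4 d1 d2 d3 d4
  have hP'1 := norm_sub_one_le_sixteen hθ0 hθ1 hE'
    (norm_sum4_le (norm_lin_le hθ0 hθ1 g1 d1) (norm_lin_le hθ0 hθ1 g2 d2) (norm_lin_le hθ0 hθ1 g3 d3)
      (norm_lin_le hθ0 hθ1 g4 d4))
  -- the conjugating unit
  have h2θ : 2 * θ ≤ 1 / 4 := by linarith only [hθ1]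
  letI : CStarAlgebra (Matrix n n ℂ) := {}
  have hwU : bavg L V₀ (q - (L : ℤ) • e lam) lam ∈ unitaryUnits (Matrix n n ℂ) :=
    bavg_mem_unitaryUnits (fun y κ => hV₀ y κ) L (q - (L : ℤ) • e lam) lam fun r => (hWl r).trans h2θ
  have hwU1 : (bavg L V₀ (q - (L : ℤ) • e lam) lam)⁻¹ ∈ U1 (Matrix n n ℂ) :=
    mem_U1_of_unitary ((unitaryUnits (Matrix n n ℂ)).inv_mem hwU)
  -- the abelian first-order term
  have hgA : ∀ (y : Site d) (lam' : Fin d), l1 (y - q) ≤ d * L + 4 * L →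
      ‖asum (fun y κ => mlog ((V₀ y κ : (Matrix n n ℂ)ˣ) : Matrix n n ℂ)) (y + e lam') (plaqWord μ ν)
        - asum (fun y κ => mlog ((V₀ y κ : (Matrix n n ℂ)ˣ) : Matrix n n ℂ)) y (plaqWord μ ν)‖
        ≤ g₁ + α * a + 2 * expRem (4 * α) := by
    intro y lam' hy
    have hy' : l1 (y + e lam' - q) ≤ d * L + 4 * L + 1 := by
      have h1 : l1 (e lam') = 1 := by simpa using l1_zsmul_e (d := d) 1 lam'
      have := l1_add_le (y - q) (e lam')
      rw [h1, show y - q + e lam' = y + e lam' - q by abel] at this; omega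
    obtain ⟨-, r0⟩ := walk_linear V₀ _ q _ hα hVA (plaqWord μ ν) y (by rw [length_plaqWord]; omega)
    obtain ⟨-, r1⟩ := walk_linear V₀ _ q _ hα hVA (plaqWord μ ν) (y + e lam') (by rw [length_plaqWord]; omega)
    rw [length_plaqWord, show ((4 : ℕ) : ℝ) * α = 4 * α by norm_num] at r0 r1
    exact norm_flux_sub_le_of_transDiff (hV1 y lam') (hb y lam' (by omega)) (h44 _) (hΔ y lam') r0 r1
  have hshift := norm_coarseFlux_shift_sub_le_local hL (fun y κ => mlog ((V₀ y κ : (Matrix n n ℂ)ˣ) : Matrix n n ℂ))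
    q (d * L + 4 * L) hgA (q - (L : ℤ) • e lam) (by
      rw [show q - (L : ℤ) • e lam - q = -((L : ℤ) • e lam) by abel, l1_neg, l1_Lstep]; omega) lam (μ := μ) (ν := ν)
  rw [hq'q] at hshift
  -- rewrite the goal into the abstract assembly
  rw [rescale_apply, hxq', plaqF, plaqF, hol_rescale_plaqWord, hol_rescale_plaqWord, hx, hxq', conjR_apply]
  simp only [cplaq, Units.val_mul]
  refine norm_conj_sub_le_assembly hθ0 hwU1 hw1 ?_ ?_ hP'1 hshift
  · have e : Tside L (fun y κ => mlog ((V₀ y κ : (Matrix n n ℂ)ˣ) : Matrix n n ℂ)) q μ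
        + Tside L (fun y κ => mlog ((V₀ y κ : (Matrix n n ℂ)ˣ) : Matrix n n ℂ)) (q + (L : ℤ) • e μ) ν
        + -Tside L (fun y κ => mlog ((V₀ y κ : (Matrix n n ℂ)ˣ) : Matrix n n ℂ)) (q + (L : ℤ) • e ν) μ
        + -Tside L (fun y κ => mlog ((V₀ y κ : (Matrix n n ℂ)ˣ) : Matrix n n ℂ)) q ν
        = Tside L (fun y κ => mlog ((V₀ y κ : (Matrix n n ℂ)ˣ) : Matrix n n ℂ)) q μ
          + Tside L (fun y κ => mlog ((V₀ y κ : (Matrix n n ℂ)ˣ) : Matrix n n ℂ)) (q + (L : ℤ) • e μ) ν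
          - Tside L (fun y κ => mlog ((V₀ y κ : (Matrix n n ℂ)ˣ) : Matrix n n ℂ)) (q + (L : ℤ) • e ν) μ
          - Tside L (fun y κ => mlog ((V₀ y κ : (Matrix n n ℂ)ˣ) : Matrix n n ℂ)) q ν := by abel
    rw [← e]; exact hE
  · have e : Tside L (fun y κ => mlog ((V₀ y κ : (Matrix n n ℂ)ˣ) : Matrix n n ℂ)) (q - (L : ℤ) • e lam) μ
        + Tside L (fun y κ => mlog ((V₀ y κ : (Matrix n n ℂ)ˣ) : Matrix n n ℂ)) (q - (L : ℤ) • e lam + (L : ℤ) • e μ) ν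
        + -Tside L (fun y κ => mlog ((V₀ y κ : (Matrix n n ℂ)ˣ) : Matrix n n ℂ)) (q - (L : ℤ) • e lam + (L : ℤ) • e ν) μ
        + -Tside L (fun y κ => mlog ((V₀ y κ : (Matrix n n ℂ)ˣ) : Matrix n n ℂ)) (q - (L : ℤ) • e lam) ν
        = Tside L (fun y κ => mlog ((V₀ y κ : (Matrix n n ℂ)ˣ) : Matrix n n ℂ)) (q - (L : ℤ) • e lam) μ
          + Tside L (fun y κ => mlog ((V₀ y κ : (Matrix n n ℂ)ˣ) : Matrix n n ℂ)) (q - (L : ℤ) • e lam + (L : ℤ) • e μ) ν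
          - Tside L (fun y κ => mlog ((V₀ y κ : (Matrix n n ℂ)ˣ) : Matrix n n ℂ)) (q - (L : ℤ) • e lam + (L : ℤ) • e ν) μ
          - Tside L (fun y κ => mlog ((V₀ y κ : (Matrix n n ℂ)ˣ) : Matrix n n ℂ)) (q - (L : ℤ) • e lam) ν := by abel
    rw [← e]; exact hE'

end NearId

end

end Summit.QuantumFields.BalabanUV.T4Continuum.BlockAverageCurrentNearId
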